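import Mathlib
import Summits.NavierStokesRegularity.NavierStokesRegularity.Theorems.ThreadingFluxAzimuthalCartanCrossFlowSteadyNS
import Summits.NavierStokesRegularity.NavierStokesRegularity.Theorems.ThreadingFluxSilentShellsTwoAxesTools
import HarnessLib

/-!
# Crux `PoloidalLiouville` (stmt-NavierStokesRegularity-1222, wall W1), crux idea «azimuthal-cartan-test» (ns-idea-15 g10):
# THE SECTORIAL CROSS FLOW HAS NO SYMMETRY AXIS (K♭, the rigidity-negating part)

Support file (`--supports stmt-NavierStokesRegularity-1222`, helper; cell `ns-wall-extremal`, width hand ns-wall-eng-7 g7, 0 kit).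
For `u = crossFlow γ`, `γ ≠ 0`, on `ball xTest 1` (`xTest = (3, 0, 4)`):

* `curl_crossFlow_xTest_ne_zero` — `curl u (xTest) = −(e^{−γ log²3}/3) e₁ ≠ 0` (the flow is NOT potential);
* `not_isMinusOneHomogeneousOn_crossFlow` — `Du(xTest) xTest ≠ −u(xTest)` (first components `2γ(log 3 − 1)/3` vs `2γ log 3 /3`):
  the flow is NOT (−1)-homogeneous about `0`, so it is a genuine test of C♭ (whose non-homogeneity clause excludes the conical flows);
* ★ `crossFlow_noAxis` — there is NO skew `A ≠ 0` with `Du(x)[A x] = A u(x)` on the ball (a fortiori none with constant swirl):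
  writing `A = w × ·` (tree `SilentShells.TwoAxes.exists_cross_of_skew`), the equivariance identity at the two points `(3, 0, 4)` and
  `(3, 0, 9/2)` of the meridian plane `{x₁ = 0}` (where `φ = 0`, `ρ = 3`) is six linear equations in `w` with coefficients in
  `γ`, `log 3`, `e^{−γ log²3}`, `G_γ(3)`; they force `w = 0` because `e^{−γ log²3} > 0`, `γ ≠ 0` and `log 3 ≠ 1` (`e < 3`, Mathlib
  `Real.exp_one_lt_three`).  The swirl clause of C♭'s conclusion is not even needed.

HONEST FRAME: explicit linear algebra at two points; closes no crux or sketch Prop by itself (the assembly `SectorialCrossFlows` follows in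
the by-name file); `PoloidalLiouville` (1222) and NS regularity OPEN.
-/

-- the summit and its single sub-problem share the name (CONVENTIONS §1)
set_option linter.dupNamespace false

noncomputable section

namespace Summit.NavierStokesRegularity.NavierStokesRegularity.Theorems.PoloidalLiouville.AzimuthalCartan.CrossFlow

open Set Function Filter Topology Metric
open scoped ContDiff RealInnerProductSpace
open Literature.Analysis.FluidPDE (curl cross)
open Summit.NavierStokesRegularity.NavierStokesRegularity.Theorems.PoloidalLiouville.CentreJet (E3)
open Summit.NavierStokesRegularity.NavierStokesRegularity.Theorems.PoloidalLiouville.AzimuthalCartan.HalfSpace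
open Summit.NavierStokesRegularity.NavierStokesRegularity.Theorems.PoloidalLiouville.AzimuthalCartan.Axial
-- components of the cross product (tree lemmas, `RotatingEulerWindowProfileLinearRung`)
open Summit.NavierStokesRegularity.NavierStokesRegularity.Theorems.RotatingEulerWindowProfileLinearRung
  (cross_apply_zero cross_apply_one cross_apply_two)

variable (γ : ℝ)

/-! ### The meridian plane `{x₀ = 3, x₁ = 0}` through the test point -/

section Plane

variable {p : E3} (h0 : p 0 = 3) (h1 : p 1 = 0)
include h0 h1

omit h1 in
/-- Points of the meridian plane lie in the half-space. -/
theorem plane_pos : 0 < p 0 := by rw [h0]; norm_num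

/-- `x₀² + x₁² = 9` on the meridian plane. -/
theorem cylSq_plane : p 0 ^ 2 + p 1 ^ 2 = 9 := by rw [h0, h1]; norm_num

/-- `ρ = 3` on the meridian plane. -/
theorem cylRadius_plane : cylRadius p = 3 := by
  have h : cylRadius p ^ 2 = 3 ^ 2 := by rw [HalfSpace.cylRadius_sq, cylSq_plane h0 h1]; norm_num
  have hp := cylRadius_pos (plane_pos h0)
  nlinarith [hp]

omit h0 in
/-- `φ = 0` on the meridian plane. -/
theorem azimuth_plane : azimuth p = 0 := by
  rw [azimuth, h1, zero_div, Real.arctan_zero]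

/-- The cross flow on the meridian plane: `u = (−2γ log 3/3, 0, G(3))`. -/
theorem crossFlow_plane_zero : crossFlow γ p 0 = -(2 * γ * Real.log 3 / 3) := by
  rw [crossFlow_apply_zero, azimuth_plane h1, cylRadius_plane h0 h1, h0, h1]
  ring

/-- Second component of the cross flow on the meridian plane (zero). -/
theorem crossFlow_plane_one : crossFlow γ p 1 = 0 := by
  rw [crossFlow_apply_one, azimuth_plane h1, cylRadius_plane h0 h1, h0, h1]
  ring

/-- Third component of the cross flow on the meridian plane: `G(3)`. -/
theorem crossFlow_plane_two : crossFlow γ p 2 = crossFlowAxial γ 3 := by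
  rw [crossFlow_apply_two, cylRadius_plane h0 h1]

/-- The derivative on the meridian plane: `Du(p) v = (2γ(log 3 − 1)v₀/9, −2γ(log 3 − 1)v₁/9, e^{−γ log²3} v₀/3)`. -/
theorem fderiv_crossFlow_plane_zero (v : E3) :
    fderiv ℝ (crossFlow γ) p v 0 = 2 * γ * (Real.log 3 - 1) / 9 * v 0 := by
  rw [fderiv_crossFlow_apply_zero γ (plane_pos h0), azimuth_plane h1, cylRadius_plane h0 h1, h0, h1]
  ring

/-- Second coordinate of `Du(p) v` on the meridian plane. -/
theorem fderiv_crossFlow_plane_one (v : E3) :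
    fderiv ℝ (crossFlow γ) p v 1 = -(2 * γ * (Real.log 3 - 1) / 9) * v 1 := by
  rw [fderiv_crossFlow_apply_one γ (plane_pos h0), azimuth_plane h1, cylRadius_plane h0 h1, h0, h1]
  ring

/-- Third coordinate of `Du(p) v` on the meridian plane. -/
theorem fderiv_crossFlow_plane_two (v : E3) :
    fderiv ℝ (crossFlow γ) p v 2 = Real.exp (-(γ * Real.log 3 ^ 2)) / 3 * v 0 := by
  rw [fderiv_crossFlow_apply_two γ (plane_pos h0), cylRadius_plane h0 h1, h0, h1]
  ring

/-- **The equivariance identity on the meridian plane, components 2 and 1.**  If `Du(p)[w × p] = w × u(p)` then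
`e^{−γ log²3} w₁ p₂ /3 = (2γ log 3/3) w₁` and `−2γ(log 3 − 1)(3w₂ − w₀p₂)/9 = −(2γ log 3/3) w₂ − w₀ G(3)`. -/
theorem equivariance_plane {w : E3} (hE : fderiv ℝ (crossFlow γ) p (cross w p) = cross w (crossFlow γ p)) :
    Real.exp (-(γ * Real.log 3 ^ 2)) / 3 * (w 1 * p 2) = 2 * γ * Real.log 3 / 3 * w 1 ∧
    -(2 * γ * (Real.log 3 - 1) / 9) * (w 2 * 3 - w 0 * p 2) = w 2 * (-(2 * γ * Real.log 3 / 3)) - w 0 * crossFlowAxial γ 3 := by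
  have e2 := congrArg (fun u : E3 => u 2) hE
  have e1 := congrArg (fun u : E3 => u 1) hE
  simp only at e2 e1
  rw [fderiv_crossFlow_plane_two γ h0 h1, cross_apply_zero, cross_apply_two, crossFlow_plane_zero γ h0 h1,
    crossFlow_plane_one γ h0 h1, h1] at e2
  rw [fderiv_crossFlow_plane_one γ h0 h1, cross_apply_one, cross_apply_one, crossFlow_plane_zero γ h0 h1,
    crossFlow_plane_two γ h0 h1, h0] at e1
  constructor
  · have e2' : Real.exp (-(γ * Real.log 3 ^ 2)) / 3 * (w 1 * p 2 - w 2 * 0) = w 0 * 0 - w 1 * -(2 * γ * Real.log 3 / 3) := e2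
    linear_combination e2'
  · linear_combination e1

end Plane

/-! ### The test point and a second point of the plane -/

/-- The second point `(3, 0, 9/2)` of the meridian plane, inside `ball xTest 1`. -/
theorem xTest'_mem_ball : (xTest + EuclideanSpace.single 2 (1 / 2 : ℝ) : E3) ∈ ball xTest 1 := by
  rw [mem_ball, dist_eq_norm, add_sub_cancel_left, PiLp.norm_single]
  norm_num

/-- The second point has `x₀ = 3`. -/
theorem xTest'_apply_zero : (xTest + EuclideanSpace.single 2 (1 / 2 : ℝ) : E3) 0 = 3 := by simp

/-- The second point has `x₁ = 0`. -/
theorem xTest'_apply_one : (xTest + EuclideanSpace.single 2 (1 / 2 : ℝ) : E3) 1 = 0 := by simp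

/-- The second point has `x₂ = 9/2`. -/
theorem xTest'_apply_two : (xTest + EuclideanSpace.single 2 (1 / 2 : ℝ) : E3) 2 = 9 / 2 := by
  simp
  norm_num

/-! ### `curl u ≠ 0` and non-homogeneity at the test point -/

/-- `curl u (xTest) = −(e^{−γ log²3}/3) e₁`: its second component. -/
theorem curl_crossFlow_xTest_apply_one : curl (crossFlow γ) xTest 1 = -(Real.exp (-(γ * Real.log 3 ^ 2)) / 3) := by
  rw [curl_crossFlow γ (plane_pos xTest_apply_zero), cylRadius_plane xTest_apply_zero xTest_apply_one,
    xTest_apply_zero, xTest_apply_one]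
  simp
  ring

/-- **`curl u (xTest) ≠ 0`.** -/
theorem curl_crossFlow_xTest_ne_zero : curl (crossFlow γ) xTest ≠ 0 := by
  intro h
  have h1 := congrArg (fun u : E3 => u 1) h
  simp only [curl_crossFlow_xTest_apply_one, PiLp.zero_apply] at h1
  have hE : 0 < Real.exp (-(γ * Real.log 3 ^ 2)) := Real.exp_pos _
  linarith

/-- The cross flow has non-zero vorticity somewhere on `ball xTest 1`. -/
theorem exists_curl_crossFlow_ne_zero : ∃ x ∈ ball xTest 1, curl (crossFlow γ) x ≠ 0 :=
  ⟨xTest, mem_ball_self one_pos, curl_crossFlow_xTest_ne_zero γ⟩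

/-- **The cross flow is not (−1)-homogeneous about `0`** on `ball xTest 1` (for `γ ≠ 0`). -/
theorem not_isMinusOneHomogeneousOn_crossFlow (hγ : γ ≠ 0) : ¬ IsMinusOneHomogeneousOn (ball xTest 1) 0 (crossFlow γ) := by
  intro h
  have h1 := congrArg (fun u : E3 => u 0) (h xTest (mem_ball_self one_pos))
  simp only [sub_zero, PiLp.neg_apply] at h1
  rw [fderiv_crossFlow_plane_zero γ xTest_apply_zero xTest_apply_one, crossFlow_plane_zero γ xTest_apply_zero xTest_apply_one,
    xTest_apply_zero] at h1
  apply hγ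
  linarith

/-! ### No symmetry axis -/

/-- Polarisation: `⟪A x, x⟫ = 0` for all `x` makes `A` skew-adjoint. -/
theorem skew_of_inner_self_eq_zero {A : E3 →L[ℝ] E3} (h : ∀ x : E3, ⟪A x, x⟫ = 0) (x y : E3) : ⟪A x, y⟫ = -⟪x, A y⟫ := by
  have hxy := h (x + y)
  rw [map_add, inner_add_left, inner_add_right, inner_add_right, h x, h y, zero_add, add_zero] at hxy
  rw [real_inner_comm (A y) x]
  linarith

/-- `log 3 ≠ 1` (`e < 3`). -/
theorem log_three_ne_one : Real.log 3 ≠ 1 := by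
  have h : 1 < Real.log 3 := by
    rw [← Real.log_exp 1]
    exact Real.log_lt_log (Real.exp_pos 1) Real.exp_one_lt_three
  exact h.ne'

/-- ★ **No symmetry axis**: no non-zero skew `A` makes the cross flow infinitesimally `A`-equivariant about `0` on `ball xTest 1`
(`γ ≠ 0`); in particular the conclusion of C♭ `SteadyLocalRigidityOffCentre` fails for it. -/
theorem crossFlow_noAxis (hγ : γ ≠ 0) :
    ¬ ∃ A : E3 →L[ℝ] E3, IsSkewAxis A ∧ IsEquivariantOn (ball xTest 1) 0 A (crossFlow γ) ∧
      HasConstantSwirlOn (ball xTest 1) 0 A (crossFlow γ) := by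
  rintro ⟨A, ⟨hskew, hA0⟩, hE, -⟩
  obtain ⟨w, hw⟩ := SilentShells.TwoAxes.exists_cross_of_skew A (skew_of_inner_self_eq_zero hskew)
  -- the equivariance identity at the two points of the meridian plane
  have hEq : ∀ p ∈ ball xTest 1, fderiv ℝ (crossFlow γ) p (cross w p) = cross w (crossFlow γ p) := fun p hp => by
    have h := hE p hp
    rwa [sub_zero, hw, hw] at h
  obtain ⟨ha2, ha1⟩ := equivariance_plane γ xTest_apply_zero xTest_apply_one (hEq xTest (mem_ball_self one_pos))
  obtain ⟨hb2, hb1⟩ := equivariance_plane γ xTest'_apply_zero xTest'_apply_one (hEq _ xTest'_mem_ball)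
  rw [xTest_apply_two] at ha2 ha1
  rw [xTest'_apply_two] at hb2 hb1
  have hEpos : 0 < Real.exp (-(γ * Real.log 3 ^ 2)) := Real.exp_pos _
  have hl := log_three_ne_one
  -- `w₁ = 0` from the third components
  have hw1 : w 1 = 0 := by
    have h : Real.exp (-(γ * Real.log 3 ^ 2)) * w 1 = 0 := by linear_combination (6 : ℝ) * hb2 - (6 : ℝ) * ha2
    exact (mul_eq_zero.1 h).resolve_left hEpos.ne'
  -- `w₀ = 0`, then `w₂ = 0`, from the second components
  have hw0 : w 0 = 0 := by
    have h : γ * (Real.log 3 - 1) * w 0 = 0 := by linear_combination (-(9 : ℝ)) * ha1 + (9 : ℝ) * hb1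
    rcases mul_eq_zero.1 h with h' | h'
    · rcases mul_eq_zero.1 h' with h'' | h''
      · exact absurd h'' hγ
      · exact absurd (sub_eq_zero.1 h'') hl
    · exact h'
  have hw2 : w 2 = 0 := by
    rw [hw0] at ha1
    have h : γ * w 2 = 0 := by linear_combination ((3 : ℝ) / 2) * ha1
    exact (mul_eq_zero.1 h).resolve_left hγ
  -- hence `A = 0`
  apply hA0
  ext y i
  rw [hw]
  have hw' : w = 0 := by ext j; fin_cases j <;> simp [hw0, hw1, hw2]
  rw [hw']
  simp [cross, crossProduct]

end Summit.NavierStokesRegularity.NavierStokesRegularity.Theorems.PoloidalLiouville.AzimuthalCartan.CrossFlow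

end
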